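import Literature.Probability.RandomPlanarGeometry.HexSAWPolygonConcatenation
import HarnessLib

/-!
# The one-brick join of honeycomb walks under DISJOINTNESS hypotheses (the merge step S3ℍ of LINE «HEX-MADRAS»)

Topic `Literature/Probability/RandomPlanarGeometry` (lane «pcv-sawmu», a-p4 g12; continues `HexSAWPolygonConcatenation.lean` (a-p4 g8, G1): the brick
join `HexBW.PolygonConcat.glue m ω j D` of a walk `ω ∈ endAt n x` at a vertical bond `{ω j, ω (j+1)}` with a detour `D` of length `m` from
`ω j + 2e₀` to `ω (j+1) + 2e₀`, and its membership lemma `glue_mem` under the GLOBAL hypothesis that the bond lies in `ω`'s rightmost column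
(`∀ i ≤ n, ω i 0 ≤ ω j 0`) with `D` in the half-plane `{a ≥ ω j 0 + 2}` (`DetourOK.col`)).

Why this file.  Madras' `√N`-gain join (`DESIGN-hex-join-S234.md`) merges two polygons across one brick at a FIRST-TOUCH position, where the left
polygon is NOT globally left of the junction column — only disjoint from the (capped, translated) right polygon and row-wise separated near it.  The
injectivity part of `glue_mem` uses the column zones only to SEPARATE the three kinds of sites (ω-sites, the two connector sites `ω j + e₀`,
`ω (j+1) + e₀`, detour sites); here the same conclusion is proved from the separations themselves: **`glue_mem_of_disjoint`** — if `D` is a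
self-avoiding brick-wall walk from `ω j + 2e₀` to `ω (j+1) + 2e₀` avoiding `ω`, and the two connector sites avoid both `ω` and `D`, then
`glue m ω j D ∈ endAt (n + m + 3) x`.  The T1 contact type of the ℍ cap table (facing down-bonds two columns apart, middle sites free) is exactly this
with `D` = the right polygon cut at its facing bond; the other types apply it after their caps.

Source: N. Madras, G. Slade, *The Self-Avoiding Walk* (1993), §3.2, proof of Theorem 3.2.3 pp. 64–65 (the concatenation of two polygons across one
lattice cell; on `ℤ^d` the separating hyperplane gives disjointness — here disjointness is the hypothesis); N. Madras, J. Stat. Phys. 78 (1995) §2 /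
A. Hammond arXiv:1504.05286v5 §4.1 Definition 4.3 p. 20 (the Madras join polygon: "remove the edges … and add the two horizontal edges").

## Contents (namespace `…SAW.HexBW.PolygonConcat`; all `theorem`s, axioms standard)
* `DetourFree n m ω j D` — the detour hypotheses with disjointness in place of columns;
* **`glue_mem_of_disjoint (hω : ω ∈ endAt n x) (hj : j < n) (hv : ω (j+1) 0 = ω j 0) (hD : DetourFree n m ω j D) : glue m ω j D ∈ endAt (n + m + 3) x`**;
* `detourFree_of_detourOK` — the tree's column hypotheses imply the disjointness ones (so `glue_mem` is the special case);
* **`detourFree_detour`** — the tree's `detour m ω υ j k` (the rooted polygon `υ` cut at its vertical bond `k`, re-rooted, translated by `v`) is a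
  `DetourFree` detour as soon as the bond of `υ + v` faces the bond of `ω` two columns to the right, `υ + v` avoids `ω`, and the two middle
  sites are free; **`glue_detour_mem`** — then `glue m ω j (detour m ω υ j k) ∈ endAt (n + m + 3) x` (the T1 merge of the ℍ cap table).
-/

noncomputable section

open Finset Function Literature.Probability.LatticeModels Literature.Probability.Percolation SimpleGraph

namespace Literature.Probability.RandomPlanarGeometry.SAW

namespace HexBW

namespace PolygonConcat

variable {n m : ℕ} {ω D : ℕ → Site 2} {j : ℕ} {x : Site 2}

/-- first coordinate after a right step. [folklore] -/
private theorem add_e0_zero (z : Site 2) : (z + (Pi.single 0 1 : Site 2)) 0 = z 0 + 1 := by simp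
/-- second coordinate after a right step. [folklore] -/
private theorem add_e0_one (z : Site 2) : (z + (Pi.single 0 1 : Site 2)) 1 = z 1 := by simp

/-- **The detour hypotheses, disjointness form**: `D` runs from `ω j + 2e₀` to `ω (j+1) + 2e₀` by brick-wall bonds, injectively on `[0, m]`, avoids
the sites of `ω` on `[0, n]`, and the two connector sites `ω j + e₀`, `ω (j+1) + e₀` are neither sites of `ω` nor of `D`.
[cite: MadrasSlade1993, §3.2 (proof of Theorem 3.2.3, pp. 64–65); Hammond2015SAPJoining, Definition 4.3 (arXiv v5 p. 20)] -/
structure DetourFree (n m : ℕ) (ω : ℕ → Site 2) (j : ℕ) (D : ℕ → Site 2) : Prop where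
  start : D 0 = ω j + (Pi.single 0 1 : Site 2) + (Pi.single 0 1 : Site 2)
  finish : D m = ω (j + 1) + (Pi.single 0 1 : Site 2) + (Pi.single 0 1 : Site 2)
  adj : ∀ i, i < m → brickWallGraph.Adj (D i) (D (i + 1))
  inj : Set.InjOn D {i | i ≤ m}
  disj : ∀ i, i ≤ m → ∀ i', i' ≤ n → D i ≠ ω i'
  conn₁_ω : ∀ i', i' ≤ n → ω i' ≠ ω j + (Pi.single 0 1 : Site 2)
  conn₂_ω : ∀ i', i' ≤ n → ω i' ≠ ω (j + 1) + (Pi.single 0 1 : Site 2)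
  conn₁_D : ∀ i, i ≤ m → D i ≠ ω j + (Pi.single 0 1 : Site 2)
  conn₂_D : ∀ i, i ≤ m → D i ≠ ω (j + 1) + (Pi.single 0 1 : Site 2)

/-- **The brick join is a self-avoiding brick-wall walk under the disjointness hypotheses**: `glue m ω j D ∈ endAt (n + m + 3) x`.
(Steps: as in the tree's `glue_mem`; injectivity: ω-times are separated from connector times by `conn₁_ω/conn₂_ω`, from detour times by `disj`,
the two connectors from each other by their rows, connectors from detour times by `conn₁_D/conn₂_D`, and within each kind by `ω`'s / `D`'s own
injectivity.) [cite: MadrasSlade1993, §3.2 (proof of Theorem 3.2.3, pp. 64–65); Hammond2015SAPJoining, Definition 4.3 (arXiv v5 p. 20)] -/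
theorem glue_mem_of_disjoint (hω : ω ∈ endAt n x) (hj : j < n) (hv : ω (j + 1) 0 = ω j 0) (hD : DetourFree n m ω j D) :
    glue m ω j D ∈ endAt (n + m + 3) x := by
  obtain ⟨⟨h0, hend, hbw, hinj⟩, hn'⟩ := mem_endAt_iff.1 hω
  have hy : ω (j + 1) 1 ≠ ω j 1 := by
    rcases vertical_cases (hbw j hj) hv with ⟨h1, -⟩ | ⟨h1, -⟩ <;> omega
  rw [mem_endAt_iff]
  refine ⟨⟨by rw [glue_of_le (Nat.zero_le _), h0], ?_, ?_, ?_⟩, ?_⟩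
  · -- frozen after `n + m + 3`
    intro i hi
    rw [glue_of_ge (by omega), glue_of_ge (by omega), hend _ (by omega), show n + m + 3 - (m + 3) = n by omega]
  · -- steps (verbatim from the tree's `glue_mem`)
    intro i hi
    rcases Nat.lt_or_ge i j with h1 | h1
    · rw [glue_of_le h1.le, glue_of_le (by omega)]; exact hbw i (by omega)
    rcases eq_or_lt_of_le h1 with rfl | h2
    · rw [glue_of_le le_rfl, glue_conn1]; exact adj_add_e0 _
    by_cases h3 : i = j + 1
    · subst h3; rw [glue_conn1, show j + 1 + 1 = j + 2 + 0 by omega, glue_detour (Nat.zero_le _), hD.start]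
      exact adj_add_e0 _
    by_cases h4 : i < j + 2 + m
    · obtain ⟨l, rfl⟩ : ∃ l, i = j + 2 + l := ⟨i - (j + 2), by omega⟩
      rw [glue_detour (by omega), show j + 2 + l + 1 = j + 2 + (l + 1) by omega, glue_detour (by omega)]
      exact hD.adj l (by omega)
    by_cases h5 : i = j + 2 + m
    · subst h5; rw [glue_detour le_rfl, hD.finish, show j + 2 + m + 1 = j + m + 3 by omega, glue_conn2]
      exact adj_add_e0_symm _
    by_cases h6 : i = j + m + 3
    · subst h6; rw [glue_conn2, glue_of_ge (by omega), show j + m + 3 + 1 - (m + 3) = j + 1 by omega]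
      exact adj_add_e0_symm _
    · rw [glue_of_ge (by omega), glue_of_ge (by omega), show i + 1 - (m + 3) = i - (m + 3) + 1 by omega]
      exact hbw _ (by omega)
  · -- injective on `[0, n+m+3]`: three kinds of times
    -- kind ω: `i ≤ j` (value `ω i`) or `j + m + 4 ≤ i ≤ n + m + 3` (value `ω (i − (m+3))`); kind B: `j+1`, `j+m+3`; kind D: `j+2+l`, `l ≤ m`
    have vB1 : glue m ω j D (j + 1) = ω j + (Pi.single 0 1 : Site 2) := glue_conn1
    have vB2 : glue m ω j D (j + m + 3) = ω (j + 1) + (Pi.single 0 1 : Site 2) := glue_conn2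
    suffices key : ∀ i i', i < i' → i' ≤ n + m + 3 → glue m ω j D i ≠ glue m ω j D i' by
      intro i hi i' hi' h
      simp only [Set.mem_setOf_eq] at hi hi'
      by_contra hne
      rcases Nat.lt_or_gt_of_ne hne with hlt | hlt
      · exact key i i' hlt hi' h
      · exact key i' i hlt hi h.symm
    intro i i' hlt hi' h
    rcases Nat.lt_or_ge i (j + 1) with hiA | hiA
    · -- `i` of kind ω (first part), value `ω i`
      rw [glue_of_le (by omega)] at h
      rcases Nat.lt_or_ge i' (j + 1) with hi'A | hi'A
      · rw [glue_of_le (by omega)] at h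
        have := hinj (show i ∈ {i | i ≤ n} by simp only [Set.mem_setOf_eq]; omega)
          (show i' ∈ {i | i ≤ n} by simp only [Set.mem_setOf_eq]; omega) h
        omega
      by_cases hi'B : i' = j + 1
      · subst hi'B; rw [vB1] at h; exact hD.conn₁_ω i (by omega) h
      rcases Nat.lt_or_ge i' (j + m + 3) with hi'C | hi'C
      · obtain ⟨l, rfl⟩ : ∃ l, i' = j + 2 + l := ⟨i' - (j + 2), by omega⟩
        rw [glue_detour (by omega)] at h
        exact hD.disj l (by omega) i (by omega) h.symm
      by_cases hi'B2 : i' = j + m + 3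
      · subst hi'B2; rw [vB2] at h; exact hD.conn₂_ω i (by omega) h
      · rw [glue_of_ge (by omega)] at h
        have := hinj (show i ∈ {i | i ≤ n} by simp only [Set.mem_setOf_eq]; omega)
          (show i' - (m + 3) ∈ {i | i ≤ n} by simp only [Set.mem_setOf_eq]; omega) h
        omega
    by_cases hiB : i = j + 1
    · subst hiB
      rw [vB1] at h
      rcases Nat.lt_or_ge i' (j + m + 3) with hi'C | hi'C
      · obtain ⟨l, rfl⟩ : ∃ l, i' = j + 2 + l := ⟨i' - (j + 2), by omega⟩
        rw [glue_detour (by omega)] at h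
        exact hD.conn₁_D l (by omega) h.symm
      by_cases hi'B2 : i' = j + m + 3
      · subst hi'B2
        rw [vB2] at h
        have h1c := congrArg (fun z : Site 2 => z 1) h
        simp only [add_e0_one] at h1c
        exact hy h1c.symm
      · rw [glue_of_ge (by omega)] at h
        exact hD.conn₁_ω (i' - (m + 3)) (by omega) h.symm
    rcases Nat.lt_or_ge i (j + m + 3) with hiC | hiC
    · obtain ⟨l, rfl⟩ : ∃ l, i = j + 2 + l := ⟨i - (j + 2), by omega⟩
      rw [glue_detour (by omega)] at h
      rcases Nat.lt_or_ge i' (j + m + 3) with hi'C | hi'C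
      · obtain ⟨l', rfl⟩ : ∃ l', i' = j + 2 + l' := ⟨i' - (j + 2), by omega⟩
        rw [glue_detour (by omega)] at h
        have := hD.inj (show l ∈ {i | i ≤ m} by simp only [Set.mem_setOf_eq]; omega)
          (show l' ∈ {i | i ≤ m} by simp only [Set.mem_setOf_eq]; omega) h
        omega
      by_cases hi'B2 : i' = j + m + 3
      · subst hi'B2; rw [vB2] at h; exact hD.conn₂_D l (by omega) h
      · rw [glue_of_ge (by omega)] at h
        exact hD.disj l (by omega) (i' - (m + 3)) (by omega) h
    by_cases hiB2 : i = j + m + 3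
    · subst hiB2
      rw [vB2, glue_of_ge (by omega)] at h
      exact hD.conn₂_ω (i' - (m + 3)) (by omega) h.symm
    · rw [glue_of_ge (by omega), glue_of_ge (by omega)] at h
      have := hinj (show i - (m + 3) ∈ {i | i ≤ n} by simp only [Set.mem_setOf_eq]; omega)
        (show i' - (m + 3) ∈ {i | i ≤ n} by simp only [Set.mem_setOf_eq]; omega) h
      omega
  · -- endpoint
    rw [glue_of_ge (by omega), show n + m + 3 - (m + 3) = n by omega, hn']

/-- **The tree's column hypotheses imply the disjointness ones** (so `glue_mem` is the special case of `glue_mem_of_disjoint`): if the bond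
`{ω j, ω (j+1)}` lies in `ω`'s rightmost column and `D` in the half-plane `{a ≥ ω j 0 + 2}`.
[cite: MadrasSlade1993, §3.2 (proof of Theorem 3.2.3: the separating line)] -/
theorem detourFree_of_detourOK (hv : ω (j + 1) 0 = ω j 0) (hX : ∀ i, i ≤ n → ω i 0 ≤ ω j 0) (hD : DetourOK m ω j D) :
    DetourFree n m ω j D := by
  refine ⟨hD.start, hD.finish, hD.adj, hD.inj, fun i hi i' hi' h => ?_, fun i' hi' h => ?_, fun i' hi' h => ?_,
    fun i hi h => ?_, fun i hi h => ?_⟩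
  · have h1 := hD.col i hi; have h2 := hX i' hi'; rw [h] at h1; omega
  · have h1 := hX i' hi'; have h2 := congrArg (fun z : Site 2 => z 0) h; simp only [add_e0_zero] at h2; omega
  · have h1 := hX i' hi'; have h2 := congrArg (fun z : Site 2 => z 0) h; simp only [add_e0_zero] at h2; omega
  · have h1 := hD.col i hi; have h2 := congrArg (fun z : Site 2 => z 0) h; simp only [add_e0_zero] at h2; omega
  · have h1 := hD.col i hi; have h2 := congrArg (fun z : Site 2 => z 0) h; simp only [add_e0_zero] at h2; omega

/-! ### The detour cut from a translated polygon, under disjointness -/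

section Detour

variable {υ : ℕ → Site 2} {k : ℕ}

/-- rows of a translate landing two columns right. [folklore] -/
private theorem row_of_add_eq {a v b : Site 2} (h : a + v = b + (Pi.single 0 1 : Site 2) + (Pi.single 0 1 : Site 2)) :
    a 1 + v 1 = b 1 := by
  have := congrArg (fun z : Site 2 => z 1) h
  simpa using this
/-- columns of a translate landing two columns right. [folklore] -/
private theorem col_of_add_eq {a v b : Site 2} (h : a + v = b + (Pi.single 0 1 : Site 2) + (Pi.single 0 1 : Site 2)) :
    a 0 + v 0 = b 0 + 2 := by
  have := congrArg (fun z : Site 2 => z 0) h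
  simp at this
  omega

/-- **The tree's `detour` is a `DetourFree` detour under disjointness**: let `{ω j, ω (j+1)}` and `{υ k, υ (k+1)}` be vertical bonds of
`ω ∈ endAt n x` and of the rooted polygon `υ ∈ endAt m e₀`, and let `v` be a translation putting the bond of `υ` onto the bond facing
`{ω j, ω (j+1)}` two columns to the right (in either orientation); if the translate `υ + v` avoids `ω` and the two middle sites `ω j + e₀`,
`ω (j+1) + e₀` avoid both, then `detour m ω υ j k` (the cycle of `υ` minus its bond, re-rooted and translated by exactly `v`) satisfies
`DetourFree n m ω j`.  This is the T1 merge of the ℍ cap table (`DESIGN-hex-join-S234.md`): no column hypothesis on either polygon.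
[cite: MadrasSlade1993, §3.2 (proof of Theorem 3.2.3: "translate `Q` by the vector `p − e(I) + e(1)`"); Hammond2015SAPJoining, Definition 4.3 (arXiv v5 p. 20)] -/
theorem detourFree_detour (hω : ω ∈ endAt n x) (hj : j < n) (hv : ω (j + 1) 0 = ω j 0)
    (hυ : υ ∈ endAt m (Pi.single 0 1 : Site 2)) (hk : k < m) (hvk : υ (k + 1) 0 = υ k 0) {v : Site 2}
    (hmatch : (υ k + v = ω j + (Pi.single 0 1 : Site 2) + (Pi.single 0 1 : Site 2) ∧
        υ (k + 1) + v = ω (j + 1) + (Pi.single 0 1 : Site 2) + (Pi.single 0 1 : Site 2)) ∨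
      (υ (k + 1) + v = ω j + (Pi.single 0 1 : Site 2) + (Pi.single 0 1 : Site 2) ∧
        υ k + v = ω (j + 1) + (Pi.single 0 1 : Site 2) + (Pi.single 0 1 : Site 2)))
    (hdisj : ∀ c, c ≤ m → ∀ i', i' ≤ n → υ c + v ≠ ω i')
    (hc₁ : ∀ i', i' ≤ n → ω i' ≠ ω j + (Pi.single 0 1 : Site 2)) (hc₂ : ∀ i', i' ≤ n → ω i' ≠ ω (j + 1) + (Pi.single 0 1 : Site 2))
    (hc₁' : ∀ c, c ≤ m → υ c + v ≠ ω j + (Pi.single 0 1 : Site 2)) (hc₂' : ∀ c, c ≤ m → υ c + v ≠ ω (j + 1) + (Pi.single 0 1 : Site 2)) :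
    DetourFree n m ω j (detour m ω υ j k) := by
  have hvω := vertical_cases (adj_of_mem hω hj) hv
  have hvυ := vertical_cases (adj_of_mem hυ hk) hvk
  by_cases hs : sameDir ω υ j k = true
  · have hs' : ω (j + 1) 1 - ω j 1 = υ (k + 1) 1 - υ k 1 := by simpa [sameDir] using hs
    -- the first orientation holds
    have h1 : υ k + v = ω j + (Pi.single 0 1 : Site 2) + (Pi.single 0 1 : Site 2) ∧
        υ (k + 1) + v = ω (j + 1) + (Pi.single 0 1 : Site 2) + (Pi.single 0 1 : Site 2) := by
      rcases hmatch with h | h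
      · exact h
      · exfalso
        have e1 := row_of_add_eq h.1
        have e2 := row_of_add_eq h.2
        rcases hvω with ⟨a, -⟩ | ⟨a, -⟩ <;> omega
    have hT : ω j + (Pi.single 0 1 : Site 2) + (Pi.single 0 1 : Site 2) - υ k = v := by rw [← h1.1]; abel
    have hD : ∀ i, detour m ω υ j k i = cycB m υ k i + v := fun i => by rw [detour_of_same hs, hT]
    have hte : (v 0 + v 1) % 2 = 0 := by
      have e0 := col_of_add_eq h1.1
      have e1 := row_of_add_eq h1.1
      have e1' := row_of_add_eq h1.2
      rcases hvω with ⟨a1, a2⟩ | ⟨a1, a2⟩ <;> rcases hvυ with ⟨b1, b2⟩ | ⟨b1, b2⟩ <;> omega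
    refine ⟨?_, ?_, ?_, ?_, ?_, hc₁, hc₂, ?_, ?_⟩
    · rw [hD, cycB_zero, h1.1]
    · rw [hD, cycB_last hk, h1.2]
    · intro i hi; rw [hD, hD, adj_add_iff_of_even hte]; exact cycB_adj hυ hk.le hi
    · intro i hi i' hi' h; rw [hD, hD] at h; exact cycB_injOn hυ hk.le hi hi' (add_right_cancel h)
    · intro i hi i' hi'
      obtain ⟨c, hc, hci⟩ := cycB_exists (υ := υ) hk.le i
      rw [hD, hci]; exact hdisj c hc i' hi'
    · intro i hi
      obtain ⟨c, hc, hci⟩ := cycB_exists (υ := υ) hk.le i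
      rw [hD, hci]; exact hc₁' c hc
    · intro i hi
      obtain ⟨c, hc, hci⟩ := cycB_exists (υ := υ) hk.le i
      rw [hD, hci]; exact hc₂' c hc
  · have hs0 : sameDir ω υ j k = false := by simpa using hs
    have hs' : ω (j + 1) 1 - ω j 1 ≠ υ (k + 1) 1 - υ k 1 := by simpa [sameDir] using hs
    -- the second orientation holds
    have h2 : υ (k + 1) + v = ω j + (Pi.single 0 1 : Site 2) + (Pi.single 0 1 : Site 2) ∧
        υ k + v = ω (j + 1) + (Pi.single 0 1 : Site 2) + (Pi.single 0 1 : Site 2) := by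
      rcases hmatch with h | h
      · exfalso
        have e1 := row_of_add_eq h.1
        have e2 := row_of_add_eq h.2
        exact hs' (by omega)
      · exact h
    have hT : ω j + (Pi.single 0 1 : Site 2) + (Pi.single 0 1 : Site 2) - υ (k + 1) = v := by rw [← h2.1]; abel
    have hD : ∀ i, detour m ω υ j k i = cycF m υ (k + 1) i + v := fun i => by rw [detour_of_not_same hs0, hT]
    have hte : (v 0 + v 1) % 2 = 0 := by
      have e0 := col_of_add_eq h2.1
      have e1 := row_of_add_eq h2.1
      have e1' := row_of_add_eq h2.2
      rcases hvω with ⟨a1, a2⟩ | ⟨a1, a2⟩ <;> rcases hvυ with ⟨b1, b2⟩ | ⟨b1, b2⟩ <;> omega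
    refine ⟨?_, ?_, ?_, ?_, ?_, hc₁, hc₂, ?_, ?_⟩
    · rw [hD, cycF_zero (by omega), h2.1]
    · rw [hD, cycF_last, h2.2]
    · intro i hi; rw [hD, hD, adj_add_iff_of_even hte]; exact cycF_adj hυ (by omega) hi
    · intro i hi i' hi' h; rw [hD, hD] at h; exact cycF_injOn hυ (by omega) hi hi' (add_right_cancel h)
    · intro i hi i' hi'
      obtain ⟨c, hc, hci⟩ := cycF_exists (υ := υ) (show k + 1 ≤ m by omega) hi
      rw [hD, hci]; exact hdisj c hc i' hi'
    · intro i hi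
      obtain ⟨c, hc, hci⟩ := cycF_exists (υ := υ) (show k + 1 ≤ m by omega) hi
      rw [hD, hci]; exact hc₁' c hc
    · intro i hi
      obtain ⟨c, hc, hci⟩ := cycF_exists (υ := υ) (show k + 1 ≤ m by omega) hi
      rw [hD, hci]; exact hc₂' c hc

/-- **The merge across one brick, assembled**: under the hypotheses of `detourFree_detour`, `glue m ω j (detour m ω υ j k) ∈ endAt (n + m + 3) x`
— a self-avoiding brick-wall walk of length `n + m + 3` from `0` to `x` traversing `ω`, the junction brick and the translated `υ`.
[cite: MadrasSlade1993, §3.2 (proof of Theorem 3.2.3, pp. 64–65); Hammond2015SAPJoining, Definition 4.3 (arXiv v5 p. 20: the Madras join polygon)] -/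
theorem glue_detour_mem (hω : ω ∈ endAt n x) (hj : j < n) (hv : ω (j + 1) 0 = ω j 0)
    (hυ : υ ∈ endAt m (Pi.single 0 1 : Site 2)) (hk : k < m) (hvk : υ (k + 1) 0 = υ k 0) {v : Site 2}
    (hmatch : (υ k + v = ω j + (Pi.single 0 1 : Site 2) + (Pi.single 0 1 : Site 2) ∧
        υ (k + 1) + v = ω (j + 1) + (Pi.single 0 1 : Site 2) + (Pi.single 0 1 : Site 2)) ∨
      (υ (k + 1) + v = ω j + (Pi.single 0 1 : Site 2) + (Pi.single 0 1 : Site 2) ∧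
        υ k + v = ω (j + 1) + (Pi.single 0 1 : Site 2) + (Pi.single 0 1 : Site 2)))
    (hdisj : ∀ c, c ≤ m → ∀ i', i' ≤ n → υ c + v ≠ ω i')
    (hc₁ : ∀ i', i' ≤ n → ω i' ≠ ω j + (Pi.single 0 1 : Site 2)) (hc₂ : ∀ i', i' ≤ n → ω i' ≠ ω (j + 1) + (Pi.single 0 1 : Site 2))
    (hc₁' : ∀ c, c ≤ m → υ c + v ≠ ω j + (Pi.single 0 1 : Site 2)) (hc₂' : ∀ c, c ≤ m → υ c + v ≠ ω (j + 1) + (Pi.single 0 1 : Site 2)) :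
    glue m ω j (detour m ω υ j k) ∈ endAt (n + m + 3) x :=
  glue_mem_of_disjoint hω hj hv (detourFree_detour hω hj hv hυ hk hvk hmatch hdisj hc₁ hc₂ hc₁' hc₂')

end Detour

end PolygonConcat

end HexBW

end Literature.Probability.RandomPlanarGeometry.SAW

end
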